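import Mathlib
import HarnessLib
import Summits.ValiantsHypothesis.ValiantsHypothesis.Theorems.LacunarySymmetroidMatrixDescartesProductPlusOneEulerSectorsTop
import Summits.ValiantsHypothesis.ValiantsHypothesis.Theorems.LacunarySymmetroidMatrixDescartesProductPlusOneTameK

/-!
# ValiantsHypothesis / LacunarySymmetroid — crux `MatrixDescartes` (stmt-ValiantsHypothesis-18050, V1),
# LINE (A) «product_plus_one», S4″/S5 Euler currency: the TAME SECTOR FOR EVERY K at the TOP coupling (mirror of `…TameK`)

`x ↦ 1/x` companion of `eulerBound_tameK`: window `d_{K−1} − d_0 ≤ 4(d_{K−1} − d_{K−2})` (the whole support within four times the LAST gap),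
factors with a nonzero TOP coefficient, a FREE second-from-top coefficient and all lower coefficients weakly opposite in sign to the top one,
TOP coupling `l₀ = K−1`, every format `K ≥ 2`:

* ★★ `eulerBound_tameK_top` — `Z₊(eulerNumerator d a ⟨K−1,_⟩) ≤ 2m + 1` (✓ `card_pos_roots_euler_le_reverse` + ✓ `eulerNumerator_reindex` with
  `Fin.revPerm`, as in ✓ `…CoherentKTop` / `…LowerSignedTop`);
* ★ `tameK_sector_classK_top` — members `Z₊(C c·X^{m d_{K−1}} + ∏ f_j) ≤ 2m + 2`;
* `eulerBoundK3_tameWeakTop` / `classRowK3_tameWeakTop` — the `K = 3` rows at `l₀ = 2` (`d 2 − d 0 ≤ 4(d 2 − d 1)`; `a_{j2} ≠ 0`, `a_{j0}` weakly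
  opposite, `a_{j1}` free) — the hypotheses of ✓ `eulerBoundK3_tameTop` imply them.

Honest framing: sector rung; `stub_classRowK3` / `stub_polyLaw` / 18050 / B OPEN; `VP ≠ VNP` NOT proved.  No definitions, no named facts.
-/

set_option linter.dupNamespace false

namespace Summit.ValiantsHypothesis.ValiantsHypothesis.Theorems.LacunarySymmetroidMatrixDescartes

namespace ProductPlusOne

open Polynomial Finset
open scoped BigOperators

/-- ★★ **THE TAME SECTOR AT THE TOP COUPLING, EVERY FORMAT** (`2 ≤ K`, `d` strictly increasing with `d_{K−1} − d_0 ≤ 4(d_{K−1} − d_{K−2})`,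
top coupling `l₀ = K−1`; top coefficient nonzero, second-from-top free, lower coefficients weakly opposite to the top):
`Z₊(eulerNumerator d a ⟨K−1,_⟩) ≤ 2m + 1`. [this file's theorem] -/
theorem eulerBound_tameK_top {m K : ℕ} (hK : 2 ≤ K) (d : Fin K → ℕ) (hd : StrictMono d)
    (hwin : d ⟨K - 1, by omega⟩ - d ⟨0, by omega⟩ ≤ 4 * (d ⟨K - 1, by omega⟩ - d ⟨K - 2, by omega⟩)) (a : Fin m → Fin K → ℝ)
    (ht : ∀ j, (0 < a j ⟨K - 1, by omega⟩ ∧ ∀ l : Fin K, (l : ℕ) + 3 ≤ K → a j l ≤ 0) ∨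
      (a j ⟨K - 1, by omega⟩ < 0 ∧ ∀ l : Fin K, (l : ℕ) + 3 ≤ K → 0 ≤ a j l)) :
    ((∑ j, (∑ l, C (a j l * ((d l : ℝ) - d ⟨K - 1, by omega⟩)) * X ^ (d l)) * ∏ i ∈ Finset.univ.erase j, (∑ l, C (a i l) * X ^ (d l))
      : ℝ[X]).roots.toFinset.filter (fun t => 0 < t)).card ≤ 2 * m + 1 := by
  classical
  set top : Fin K := ⟨K - 1, by omega⟩ with htop
  set D : ℕ := d top with hDdef
  have hD : ∀ l, d l ≤ D := fun l => hd.monotone (Fin.mk_le_mk.mpr (by have := l.isLt; omega) : l ≤ top)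
  refine (card_pos_roots_euler_le_reverse d D hD a top).trans ?_
  -- re-index the letters by `Fin.rev`
  set σ : Equiv.Perm (Fin K) := Fin.revPerm with hσ
  set d' : Fin K → ℕ := fun l => D - d (σ l) with hd'
  set a' : Fin m → Fin K → ℝ := fun j l => a j (σ l) with ha'
  have hσ0 : σ ⟨0, by omega⟩ = top := by
    rw [hσ, htop]; ext; simp only [Fin.revPerm_apply, Fin.val_rev]
  have hσ1 : σ ⟨1, by omega⟩ = ⟨K - 2, by omega⟩ := by
    rw [hσ]; ext; simp only [Fin.revPerm_apply, Fin.val_rev]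
  have hσtop : σ top = ⟨0, by omega⟩ := by
    rw [hσ, htop]; ext; simp only [Fin.revPerm_apply, Fin.val_rev]; omega
  have hσsymm : σ.symm top = ⟨0, by omega⟩ := by
    rw [Equiv.symm_apply_eq]; exact hσ0.symm
  have hre := eulerNumerator_reindex σ (fun l => D - d l) a top
  have hd'mono : StrictMono d' := by
    intro i j hij
    simp only [hd']
    have h1 : σ j < σ i := by
      rw [hσ]; simp only [Fin.revPerm_apply]; exact Fin.rev_lt_rev.mpr hij
    have h2 : d (σ j) < d (σ i) := hd h1
    have h3 : d (σ i) ≤ D := hD _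
    omega
  have hwin' : d' ⟨K - 1, by omega⟩ - d' ⟨0, by omega⟩ ≤ 4 * (d' ⟨1, by omega⟩ - d' ⟨0, by omega⟩) := by
    have eK : σ ⟨K - 1, by omega⟩ = ⟨0, by omega⟩ := by
      rw [hσ]; ext; simp only [Fin.revPerm_apply, Fin.val_rev]; omega
    have e0 : σ ⟨0, by omega⟩ = ⟨K - 1, by omega⟩ := by
      rw [hσ]; ext; simp only [Fin.revPerm_apply, Fin.val_rev]
    have vK : d' ⟨K - 1, by omega⟩ = D - d ⟨0, by omega⟩ := by
      show D - d (σ ⟨K - 1, by omega⟩) = D - d ⟨0, by omega⟩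
      rw [eK]
    have v0 : d' ⟨0, by omega⟩ = 0 := by
      show D - d (σ ⟨0, by omega⟩) = 0
      rw [e0]
      exact Nat.sub_self _
    have v1 : d' ⟨1, by omega⟩ = D - d ⟨K - 2, by omega⟩ := by
      show D - d (σ ⟨1, by omega⟩) = D - d ⟨K - 2, by omega⟩
      rw [hσ1]
    rw [vK, v0, v1, Nat.sub_zero, Nat.sub_zero]
    exact hwin
  have key := eulerBound_tameK (m := m) hK d' hd'mono hwin' a'
    (fun j => by
      rcases ht j with ⟨h0, h⟩ | ⟨h0, h⟩
      · refine Or.inl ⟨by simp only [ha']; rw [hσ0]; exact h0, fun l hl => ?_⟩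
        simp only [ha']
        refine h (σ l) ?_
        rw [hσ]; simp only [Fin.revPerm_apply, Fin.val_rev]; omega
      · refine Or.inr ⟨by simp only [ha']; rw [hσ0]; exact h0, fun l hl => ?_⟩
        simp only [ha']
        refine h (σ l) ?_
        rw [hσ]; simp only [Fin.revPerm_apply, Fin.val_rev]; omega)
  -- match the shapes
  have hshape : (∑ j, (∑ l, C (a j l * (((D - d l : ℕ) : ℝ) - ((D - d top : ℕ) : ℝ))) * X ^ (D - d l))
        * ∏ i ∈ Finset.univ.erase j, (∑ l, C (a i l) * X ^ (D - d l)) : ℝ[X])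
      = ∑ j, (∑ l, C (a' j l * ((d' l : ℝ) - d' ⟨0, by omega⟩)) * X ^ (d' l))
          * ∏ i ∈ Finset.univ.erase j, (∑ l, C (a' i l) * X ^ (d' l)) := by
    rw [← hre]
    simp only [ha', hd', hσsymm]
  rw [hshape]
  exact key

/-- ★ **THE TAME SECTOR AT THE TOP COUPLING, member count, EVERY FORMAT**: `Z₊(C c·X^{m d_{K−1}} + ∏ f_j) ≤ 2m + 2`. [this file's theorem] -/
theorem tameK_sector_classK_top {m K : ℕ} (hK : 2 ≤ K) (d : Fin K → ℕ) (hd : StrictMono d)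
    (hwin : d ⟨K - 1, by omega⟩ - d ⟨0, by omega⟩ ≤ 4 * (d ⟨K - 1, by omega⟩ - d ⟨K - 2, by omega⟩)) (a : Fin m → Fin K → ℝ)
    (ht : ∀ j, (0 < a j ⟨K - 1, by omega⟩ ∧ ∀ l : Fin K, (l : ℕ) + 3 ≤ K → a j l ≤ 0) ∨
      (a j ⟨K - 1, by omega⟩ < 0 ∧ ∀ l : Fin K, (l : ℕ) + 3 ≤ K → 0 ≤ a j l)) (c : ℝ) :
    ((C c * X ^ (m * d ⟨K - 1, by omega⟩) + ∏ j, ∑ l, C (a j l) * X ^ (d l) : ℝ[X]).roots.toFinset.filter (fun t => 0 < t)).card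
      ≤ 2 * m + 2 :=
  (card_pos_roots_class_le_euler d a ⟨K - 1, by omega⟩ c).trans (by have := eulerBound_tameK_top hK d hd hwin a ht; omega)

/-- **The `K = 3` row at the TOP coupling, weak tame hypotheses** (`d 0 < d 1 < d 2`, `d 2 − d 0 ≤ 4(d 2 − d 1)`; `a_{j2} ≠ 0`, `a_{j0}` weakly
opposite in sign, `a_{j1}` free): `Z₊(eulerNumerator d a 2) ≤ 2m + 1`. [this file's theorem] -/
theorem eulerBoundK3_tameWeakTop {m : ℕ} (d : Fin 3 → ℕ) (h01 : d 0 < d 1) (h12 : d 1 < d 2) (hwin : d 2 - d 0 ≤ 4 * (d 2 - d 1))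
    (a : Fin m → Fin 3 → ℝ) (ht : ∀ j, (0 < a j 2 ∧ a j 0 ≤ 0) ∨ (a j 2 < 0 ∧ 0 ≤ a j 0)) :
    ((∑ j, (∑ l, C (a j l * ((d l : ℝ) - d 2)) * X ^ (d l)) * ∏ i ∈ Finset.univ.erase j, (∑ l, C (a i l) * X ^ (d l))
      : ℝ[X]).roots.toFinset.filter (fun t => 0 < t)).card ≤ 2 * m + 1 := by
  have hd : StrictMono d := by
    refine Fin.strictMono_iff_lt_succ.2 fun i => ?_
    fin_cases i
    · exact h01
    · exact h12
  have ht' : ∀ j, (0 < a j ⟨3 - 1, by omega⟩ ∧ ∀ l : Fin 3, (l : ℕ) + 3 ≤ 3 → a j l ≤ 0) ∨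
      (a j ⟨3 - 1, by omega⟩ < 0 ∧ ∀ l : Fin 3, (l : ℕ) + 3 ≤ 3 → 0 ≤ a j l) := by
    intro j
    rcases ht j with ⟨h2, h0⟩ | ⟨h2, h0⟩
    · refine Or.inl ⟨h2, fun l hl => ?_⟩
      fin_cases l
      · exact h0
      · simp at hl
      · simp at hl
    · refine Or.inr ⟨h2, fun l hl => ?_⟩
      fin_cases l
      · exact h0
      · simp at hl
      · simp at hl
  exact eulerBound_tameK_top (by norm_num) d hd hwin a ht'

/-- **The `K = 3` row at the TOP coupling, member count, weak tame hypotheses**: `Z₊(C c·X^{m d 2} + ∏ f_j) ≤ 2m + 2`. [this file's theorem] -/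
theorem classRowK3_tameWeakTop {m : ℕ} (d : Fin 3 → ℕ) (h01 : d 0 < d 1) (h12 : d 1 < d 2) (hwin : d 2 - d 0 ≤ 4 * (d 2 - d 1))
    (a : Fin m → Fin 3 → ℝ) (ht : ∀ j, (0 < a j 2 ∧ a j 0 ≤ 0) ∨ (a j 2 < 0 ∧ 0 ≤ a j 0)) (c : ℝ) :
    ((C c * X ^ (m * d 2) + ∏ j, ∑ l, C (a j l) * X ^ (d l) : ℝ[X]).roots.toFinset.filter (fun t => 0 < t)).card
      ≤ 2 * m + 2 :=
  (card_pos_roots_class_le_euler d a 2 c).trans (by have := eulerBoundK3_tameWeakTop d h01 h12 hwin a ht; omega)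

/-- the hypotheses of ✓ `eulerBoundK3_tameTop` (`a_{j0} a_{j2} < 0`) imply the weak ones, constant `2m + 1`. -/
example {m : ℕ} (d : Fin 3 → ℕ) (h01 : d 0 < d 1) (h12 : d 1 < d 2) (hwin : d 2 - d 0 ≤ 4 * (d 2 - d 1))
    (a : Fin m → Fin 3 → ℝ) (hac : ∀ j, a j 0 * a j 2 < 0) :
    ((∑ j, (∑ l, C (a j l * ((d l : ℝ) - d 2)) * X ^ (d l)) * ∏ i ∈ Finset.univ.erase j, (∑ l, C (a i l) * X ^ (d l))
      : ℝ[X]).roots.toFinset.filter (fun t => 0 < t)).card ≤ 2 * m + 1 := by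
  refine eulerBoundK3_tameWeakTop d h01 h12 hwin a fun j => ?_
  rcases lt_or_gt_of_ne (show a j 2 ≠ 0 from fun h => by have := hac j; rw [h, mul_zero] at this; exact lt_irrefl 0 this)
    with hneg | hpos
  · exact Or.inr ⟨hneg, by have := hac j; nlinarith⟩
  · exact Or.inl ⟨hpos, by have := hac j; nlinarith⟩

end ProductPlusOne

end Summit.ValiantsHypothesis.ValiantsHypothesis.Theorems.LacunarySymmetroidMatrixDescartes
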